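import Literature.MathematicalPhysics.QuantumFieldTheory.Balaban1983to89.B9Thm312WholeDir
import Literature.MathematicalPhysics.QuantumFieldTheory.Balaban1983to89.B9Thm312WholeBlocksNbrRec

/-!
# `Balaban1983to89.B9Thm312WholeBlocksPairM` — [B9] Theorem 3.12 (p. 423) at one member and one configuration: the L² block (3.46) and the
# Hölder block (3.43)–(3.45) of a kernel family CO-READ ON THE NEIGHBOURHOOD by one Sect.-D propagator, THE MIXED MEMBER AND THE INPUT
# MEMBERS ON THE DIRECTION-PAIR FAMILY (record index order; n06-k's v4 `PairM` species)

T. Bałaban, *Propagators for lattice gauge theories in a background field*, Commun. Math. Phys. **99** (1985) 389–434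
[`Balaban1985BackgroundPropagators`, "B9"]; [4] = T. Bałaban, *Propagators and renormalization transformations for lattice
gauge theories. II*, Commun. Math. Phys. **96** (1984) 223–250 [`Balaban1984PropagatorsII`].

statement-level skeleton of published theorems with citation tags; proofs where landed; nothing here is a claim about the
Yang–Mills mass gap

THE PRINTED LOCI are those of `…B9Thm312WholeDir` and `…B9Thm312WholeBlocksNbr(Rec)` (verbatim there): (3.39)–(3.40) p. 397, (3.43)–(3.46)
p. 398, Theorem 3.3 p. 399, (3.130)–(3.131) pp. 421–422, (3.138) p. 423; [4] (2.51)–(2.54) p. 232, Lemma 2.1 (2.60)–(2.61) p. 234.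

WHY THIS FILE (successor work of the same seat; located point (O4′)).  `…BlocksNbrRec.l2Block_of_step_nbrRec` and `…BlocksNbr.holder_of_step_nbr`
read the record's MIXED L² member `K.l2 3` and the input members `K.e4`, `K.h2` through the one-slot composite `D U ∘ₗ (A ∘ₗ Dstar U)`, which
at the record's coordinate pins carries only the diagonal direction pairs.  THIS FILE proves the same two typed blocks with those three
co-readings moved to print's direction-pair family `familyOp (q ↦ ∇_{U,q.1} ∘ A ∘ ∇\*_{U,q.2})` into X × (P × P) (n06-k
`B9RWSumsReadsNbr.L2ReadsNbr … (blk ∘ Prod.fst) blk ev (familyOp …)` for the L² line, `B9RWSums344InputFam.InputReadsFam … (blk ∘ Prod.fst)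
(blkPX ∘ Prod.fst) (fun β => sliceProbe (Φ^X_β)) ev (familyOp …)` for (3.44)∕(3.45) — the species of the v4 face
`B9RWSumsDefinitePinsPairM.rows131819_definite_geo9Y_pairM`), from the direction-indexed schemas of `…B9Thm312WholeDir`:
* §1 reading level: ★ `ineq343_345_of_majorants_pairM` — `B9.Ineq343_345 K …` from the two (3.43) probe majorants read on the neighbourhood
  (`H1ReadsNbr`, unchanged: first order) and the (3.44)∕(3.45) family majorants read by `InputReadsFam` (n06-k's engine
  `lines3445_of_hasMaj_fam`);
* §2 one member, one U, one propagator A with (Δ_a − T)A = I: ★ `l2Block_of_step_pairM` — `L2Block K (mN·m·Cev·CL²·e^{rρ_f}·constL2N …) ρ_f U`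
  with the record index order 3 = the mixed pair family (`…Dir.l2bd_mixedFamily_of_step`), 4 = ∇_ν∇_μA, 5 = A∇\*_ν∇\*_μ (the reading-free
  bounds of `…BlocksNbrRec.blockBds_of_step`); ★ `holder_of_step_pairM` — `B9.Ineq343_345 K …` from (3.43) one-slot (`probe43L∕R_of_step`) and
  (3.44)∕(3.45) on the family (`…Dir.input44_family_of_step ∕ input45_family_of_step`).
The row-20 leaf consuming them is the sequel `…B9Thm312WholeLeafCompletePairM`.

HONEST SCOPE.  Kernel bookkeeping over landed modules; every operator-level input is a HYPOTHESIS SCHEMA of printed shape; nothing of [B9]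
or [4] asserted; NOT a node discharge, NOT summit progress; count-neutral; one finite lattice at a time; nothing continuum, nothing about the
mass gap.  Cell `pub-ymgap` (HUMAN RULING D-0062), Track A node N06 [B9], N06-ASSIGNMENT v1 rows 20–21 (bundle F7), seat `pub-ymgap-dag-n06-l`
(g6), 2026-08-27.
-/

namespace Literature.MathematicalPhysics.QuantumFieldTheory.Balaban1983to89.B9Thm312WholeBlocksPairM

open Literature.MathematicalPhysics.QuantumFieldTheory.Balaban1983to89
open Finset B6RandomWalk B6RandomWalkHom B9Thm34Ext B9Thm37Glue B9Thm37GlueCor36 B11SectG B9SectDSup B9SectDL2Decay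
open B9Thm37AllNorms B9Thm37AllNormsInstances B9FromB6 B9FromB6ModelSignsOn B9SectBStepWhole B9Thm312Whole B9Thm312WholeLeaf
open B9Thm312WholeLeft B9RWSums343Holder B9RWSums346Schur B9RWSumsReadsRel B9RWSumsReadsNbr B9Ineq347 B9Thm312WholeClasses
open B9Thm312WholeHolder B9Thm312WholeL2 B9Thm312WholeBlocksRel B9RWSums346SecondDiff B9Thm312WholeBlocksNbr B9Thm312WholeBlocksNbrRec
open B9RWSums344InputFam B9Thm312WholeDir

noncomputable section

/-! ## §1 Reading level: the Hölder block from (3.43) probe majorants on the neighbourhood and (3.44)∕(3.45) family majorants -/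

section Reading

variable {g : B9.Geometry} [Fintype g.Site] [DecidableEq g.Site] {R : ℝ} {H : Prop} {B : B9.Backgrounds}
variable {X Y X₃ PX PY P₃ : Type} [Fintype X] [Fintype Y] [Fintype X₃] [Fintype PX] [Fintype PY] [Fintype P₃]

omit [Fintype X] [Fintype Y] [Fintype PX] [Fintype PY] in
/-- ★ **THE HÖLDER BLOCK (3.43)–(3.45) OF A CO-READ KERNEL FAMILY from the four operator-level majorants, THE INPUT MEMBERS ON A FAMILY**: the
two probe majorants B_h(β)(Lʲη)^{1−β}e^{−δd} of Φ^Y_β∘A₁ and Φ^X_β∘A₂ ((3.43), `H1ReadsNbr`: probes within distance r of y), the input-class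
majorants K₄₄(ε)e^{−δd} of the packaged family A₃ (X → X₃, block map `blk₃`) and K₄₅(ε,β)(Lʲη)^{−β}e^{−δd} of the sliced probes `Φf β ∘ A₃` (anchors
`blkQ`) ((3.44)–(3.45), `InputReadsFam`) ⇒ `B9.Ineq343_345 K (m·CL·e^{rδ}·B_h) (e^{rδ}·K₄₄) (CL·e^{rδ}·K₄₅) δ U` (n06-k's
`line343_of_hasMajorantHom_nbr` and `lines3445_of_hasMaj_fam`). [cite: Balaban1985BackgroundPropagators, (3.43)–(3.45) p.398 + (3.39)–(3.40) p.397; Balaban1984PropagatorsII, (2.51)–(2.52) p.232] -/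
theorem ineq343_345_of_majorants_pairM (hG : GeoOK g) {K : B9.KernelFamily g B} {U : B.Cfg} (𝔭 : HolderProbes g B X Y PX PY)
    (bHX : ℝ → BlockNorm (toB6 g R H) (X → ℝ)) {Rel : g.Site → g.Site → Prop} [DecidableRel Rel] {r : ℝ}
    {blk : X → g.Site} {blkY : Y → g.Site} {blk₃ : X₃ → g.Site} {blkQ : P₃ → g.Site} {ev : g.Loc → X → ℝ} {evY : g.Loc → Y → ℝ}
    {A1 : (X → ℝ) →ₗ[ℝ] (Y → ℝ)} {A2 : (Y → ℝ) →ₗ[ℝ] (X → ℝ)} {A3 : (X → ℝ) →ₗ[ℝ] (X₃ → ℝ)} {Φf : ℝ → ((X₃ → ℝ) →ₗ[ℝ] (P₃ → ℝ))}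
    (hRd₂ : ∀ a b b', Rel b b' → g.dist a b = g.dist a b')
    {m : ℕ} (hmult : ∀ y' : g.Site, (Finset.univ.filter (fun y'' => Rel y'' y')).card ≤ m)
    {CL : ℝ} (hCL1 : 1 ≤ CL) (hCL : ∀ a a' : g.Site, g.dist a a' ≤ r → g.len a ≤ CL * g.len a')
    {Bh K44 : ℝ → ℝ} {K45 : ℝ → ℝ → ℝ} {δ : ℝ} (hBh : ∀ β, 0 ≤ β → β < 1 → 0 ≤ Bh β)
    (hK44 : ∀ ε, 0 < ε → ε ≤ 1 → 0 ≤ K44 ε) (hK45 : ∀ ε β, 0 < ε → ε ≤ 1 → 0 ≤ β → β < 1 → 0 ≤ K45 ε β) (hδ : 0 ≤ δ)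
    (hL : ∀ β, 0 ≤ β → β < 1 → HasMajorantHom (g := toB6 g R H) blk 𝔭.blkPY (𝔭.ΦY U β ∘ₗ A1)
      (fun (a b : g.Site) => Bh β * g.len a ^ (1 - β) * Real.exp (-(δ * g.dist a b))))
    (hRt : ∀ β, 0 ≤ β → β < 1 → HasMajorantHom (g := toB6 g R H) blkY 𝔭.blkPX (𝔭.ΦX U β ∘ₗ A2)
      (fun (a b : g.Site) => Bh β * g.len a ^ (1 - β) * Real.exp (-(δ * g.dist a b))))
    (h44 : ∀ ε, 0 < ε → ε ≤ 1 → HasMaj (bHX ε) (BlockNorm.ofBlocks (toB6 g R H) blk₃) A3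
      (fun (a b : g.Site) => K44 ε * Real.exp (-(δ * g.dist a b))))
    (h45 : ∀ ε β, 0 < ε → ε ≤ 1 → 0 ≤ β → β < 1 →
      HasMaj (bHX (β + ε)) (BlockNorm.ofBlocks (toB6 g R H) blkQ) (Φf β ∘ₗ A3)
        (fun (a b : g.Site) => K45 ε β * g.len a ^ (-β) * Real.exp (-(δ * g.dist a b))))
    (hH1 : H1ReadsNbr K U 𝔭 Rel r blk blkY ev evY A1 A2) (hIR : InputReadsFam K U bHX r blk₃ blkQ Φf ev A3) :
    B9.Ineq343_345 K (fun β => m * CL * Real.exp (r * δ) * Bh β) (fun ε => Real.exp (r * δ) * K44 ε)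
      (fun ε β => CL * Real.exp (r * δ) * K45 ε β) δ U := by
  have h343 := line343_of_hasMajorantHom_nbr (R := R) (H := H) hH1 hRd₂ hmult hCL1 hCL hG.tri hG.symm hBh hδ hG.lenle hL hRt
  have h3445 := lines3445_of_hasMaj_fam hIR hCL1 hCL hG.tri hG.symm hK44 hK45 hδ hG.lenpos h44 h45
  exact ⟨h343, h3445.1, h3445.2⟩

end Reading

/-! ## §2 One member, one U, one propagator: both blocks from the direction-indexed schemas -/

section OneMember

variable {g : B9.Geometry} {B : B9.Backgrounds} {X Y Z W PX PY P : Type}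
variable [Fintype X] [Fintype Y] [Fintype PX] [Fintype PY] [Fintype P] [Fintype g.Site] [DecidableEq g.Site]
variable {R₀ : ℝ} {H₀ : Prop}

omit [Fintype PX] [Fintype PY] in
/-- ★ **THEOREM 3.12 — THE L² BLOCK (3.46) OF A KERNEL FAMILY CO-READ ON THE NEIGHBOURHOOD BY ONE SECT.-D PROPAGATOR, RECORD INDEX ORDER, THE
MIXED MEMBER ON THE PAIR FAMILY** (the twin of `…BlocksNbrRec.l2Block_of_step_nbrRec` with the co-reading of `K.l2 3` moved from the one-slot
composite to `familyOp (q ↦ ∇_{U,q.1} ∘ A ∘ ∇\*_{U,q.2})` on X × (P × P), block map `blk ∘ Prod.fst`).  Data at U: A with (Δ_a − T)A = I and G₀Δ_a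
= I; Theorem 3.3 for G₀ in the sup classes (`he0 he1 he2`) and in the block-L² classes with the direction-indexed members (`hL2 : Thm33G0L2M …`);
the perturbation step on 𝔠⁽¹⁾, 𝔠⁽²⁾ (`hK1 hK2`), its derivative (`hKD`) and its block-L² bound (`hT2`); A symmetric and (∇_UA)ᵀ = A∇\*_U; [4] Lemma
2.1 as the row sum at σ and three scale transfers (γ = 1, ½, −1; Λ₁ ≧ 1 as delivered by `…Classes.scaleTransfer_rpow_of_260`); the six
co-readings `L2ReadsNbr`; the class data and the neighbourhood data.  Provisos: ρ ≦ δ₀, ρ + σ ≦ δ_K, θc < 1, B₂θ₂c² < 1, 0 ≦ ρ_f, ρ_f + σ ≦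
(1 − α)ρ, ρ_f + 2σ + αρ ≦ ρ.  Conclusion: `L2Block K (mN·m·Cev·CL²·e^{rρ_f}·constL2N …) ρ_f U`.  Nothing of print asserted.
[cite: Balaban1985BackgroundPropagators, Thm 3.12 p.423 + Thm 3.3 p.399 + (3.46) p.398 + (3.39) p.397 + (3.130)–(3.131) pp.421–422 + (3.138) p.423; Balaban1984PropagatorsII, (2.51)–(2.52) p.232 + Lemma 2.1 (2.60)–(2.61) p.234] -/
theorem l2Block_of_step_pairM (hG : GeoOK g) {K : B9.KernelFamily g B} {U : B.Cfg} (𝔬 : Ops g B X Y Z W)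
    (Dd Dds : B.Cfg → P → Module.End ℝ (X → ℝ)) (Rel : g.Site → g.Site → Prop) [DecidableRel Rel]
    (ev : g.Loc → X → ℝ) (evY : g.Loc → Y → ℝ) {A T : Module.End ℝ (X → ℝ)} {m mN : ℕ}
    {r Cev CL θ θD θ₂ B₀ B₂ δ₀ δK ρ ρf σ α c Λ₁ Λh Λm : ℝ}
    (hrow : RowSum (toB6 g R₀ H₀) σ c)
    (hθ : 0 ≤ θ) (hθD : 0 ≤ θD) (hθ₂ : 0 ≤ θ₂) (hB₀ : 0 ≤ B₀) (hB₂ : 0 ≤ B₂) (hσ : 0 ≤ σ) (hα : 0 ≤ α)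
    (hρ : 0 ≤ ρ) (hρS : ρ ≤ δ₀) (hρδ : ρ + σ ≤ δK) (hq : θ * c < 1) (hq₂ : B₂ * θ₂ * c * c < 1)
    (hρf : 0 ≤ ρf) (hρf1 : ρf + σ ≤ (1 - α) * ρ) (hρf2 : ρf + 2 * σ + α * ρ ≤ ρ)
    (hΛ₁ : 1 ≤ Λ₁) (hΛh : 0 ≤ Λh) (hΛm : 0 ≤ Λm)
    (hST1 : ScaleTransfer g ρ α Λ₁ (fun y => g.len y ^ (1 : ℝ)))
    (hSTh : ScaleTransfer g ρ α Λh (fun y => g.len y ^ (1 / 2 : ℝ)))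
    (hSTm : ScaleTransfer g ρ α Λm (fun y => g.len y ^ (-1 : ℝ)))
    (hI0 : 𝔬.G0 U * 𝔬.S0 U = 1) (hIA : (𝔬.S0 U - T) * A = 1)
    (he0 : HasMajorant (g := toB6 g R₀ H₀) 𝔬.blk (𝔬.G0 U) (fun a b => B₀ * g.len a ^ 2 * Real.exp (-(δ₀ * g.dist a b))))
    (he1 : HasMajorantHom (g := toB6 g R₀ H₀) 𝔬.blk 𝔬.blkY (𝔬.D U ∘ₗ 𝔬.G0 U)
      (fun (a b : g.Site) => B₀ * g.len a * Real.exp (-(δ₀ * g.dist a b))))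
    (he2 : HasMajorantHom (g := toB6 g R₀ H₀) 𝔬.blkY 𝔬.blk (𝔬.G0 U ∘ₗ 𝔬.Dstar U)
      (fun (a b : g.Site) => B₀ * g.len a * Real.exp (-(δ₀ * g.dist a b))))
    (hL2 : Thm33G0L2M 𝔬 Dd Dds R₀ H₀ B₂ δ₀ U)
    (hK1 : HasMaj (cNorm R₀ H₀ 𝔬.blk hG.lenle 1) (cNorm R₀ H₀ 𝔬.blk hG.lenle 1) (𝔬.G0 U ∘ₗ T)
      (fun a b => θ * Real.exp (-(δK * g.dist a b))))
    (hK2 : HasMaj (cNorm R₀ H₀ 𝔬.blk hG.lenle 2) (cNorm R₀ H₀ 𝔬.blk hG.lenle 2) (𝔬.G0 U ∘ₗ T)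
      (fun a b => θ * Real.exp (-(δK * g.dist a b))))
    (hKD : HasMaj (cNorm R₀ H₀ 𝔬.blk hG.lenle 2) (cNorm R₀ H₀ 𝔬.blkY hG.lenle 1) (𝔬.D U ∘ₗ 𝔬.G0 U ∘ₗ T)
      (fun a b => θD * Real.exp (-(δK * g.dist a b))))
    (hT2 : BlockBd (g := toB6 g R₀ H₀) 𝔬.blk 𝔬.blk T
      (fun (y y' : g.Site) => θ₂ * (g.len y)⁻¹ * (g.len y')⁻¹ * Real.exp (-(δK * g.dist y y'))))
    (hsym : IsTransposePair A A) (htr : IsTransposePair (𝔬.D U ∘ₗ A) (A ∘ₗ 𝔬.Dstar U))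
    (hRd₂ : ∀ a b b', Rel b b' → g.dist a b = g.dist a b')
    (hmult : ∀ y' : g.Site, (Finset.univ.filter (fun y'' => Rel y'' y')).card ≤ m)
    (hnbr : ∀ y : g.Site, (nbr g r y).card ≤ mN)
    (hCL1 : 1 ≤ CL) (hCL : ∀ a a' : g.Site, g.dist a a' ≤ r → g.len a ≤ CL * g.len a') (hCev : 0 ≤ Cev)
    (hl0 : L2ReadsNbr (R := R₀) (H := H₀) K 0 U Rel r Cev 𝔬.blk 𝔬.blk ev A)
    (hl1 : L2ReadsNbr (R := R₀) (H := H₀) K 1 U Rel r Cev 𝔬.blkY 𝔬.blk ev (𝔬.D U ∘ₗ A))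
    (hl2 : L2ReadsNbr (R := R₀) (H := H₀) K 2 U Rel r Cev 𝔬.blk 𝔬.blkY evY (A ∘ₗ 𝔬.Dstar U))
    (hl3 : L2ReadsNbr (R := R₀) (H := H₀) K 3 U Rel r Cev (𝔬.blk ∘ Prod.fst) 𝔬.blk ev
      (familyOp (fun q : P × P => Dd U q.1 ∘ₗ (A ∘ₗ Dds U q.2))))
    (hl4 : L2ReadsNbr (R := R₀) (H := H₀) K 4 U Rel r Cev (𝔬.blk ∘ Prod.fst) 𝔬.blk ev
      (familyOp (fun q : P × P => (Dd U q.1 ∘ₗ Dd U q.2) ∘ₗ A)))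
    (hl5 : L2ReadsNbr (R := R₀) (H := H₀) K 5 U Rel r Cev (𝔬.blk ∘ Prod.fst) 𝔬.blk ev
      (familyOp (fun q : P × P => A ∘ₗ (Dds U q.1 ∘ₗ Dds U q.2)))) :
    L2Block K (mN * m * Cev * CL ^ 2 * Real.exp (r * ρf) *
      constL2N B₀ θ θD B₂ θ₂ c Λ₁ Λh Λm (Real.sqrt (Fintype.card (P × P)))) ρf U := by
  have hΛ₁0 : 0 ≤ Λ₁ := zero_le_one.trans hΛ₁
  obtain ⟨hB0, hB1, hB2, hB4f, -, hB5f⟩ := blockBds_of_step hG 𝔬 Dd Dds hrow hθ hθD hθ₂ hB₀ hB₂ hσ hα hρ hρS hρδ hq hq₂ hρf hρf1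
    hρf2 hΛ₁0 hΛh hΛm hST1 hSTh hSTm hI0 hIA he0 he1 he2 hL2.toThm33G0L2P hK1 hK2 hKD hT2 hsym htr
  -- the constant is non-negative as soon as there is a site
  have hc : 0 ≤ c ∨ IsEmpty g.Site := by
    by_cases hne : Nonempty g.Site
    · exact Or.inl (hrow.nonneg hne.some)
    · exact Or.inr (not_nonempty_iff.mp hne)
  rcases hc with hc | hemp
  swap
  · exact fun n lam h y => (hemp.false y).elim
  set NP : ℝ := Real.sqrt (Fintype.card (P × P)) with hNP
  have hNP0 : 0 ≤ NP := Real.sqrt_nonneg _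
  have hq1 : 0 ≤ (1 - θ * c)⁻¹ := inv_nonneg.mpr (by linarith)
  have hB₀'0 : 0 ≤ B₀ * (1 - θ * c)⁻¹ := mul_nonneg hB₀ hq1
  have hC₁0 : 0 ≤ B₀ + θD * (B₀ * (1 - θ * c)⁻¹) * c := add_nonneg hB₀ (mul_nonneg (mul_nonneg hθD hB₀'0) hc)
  have hq₂1 : 0 ≤ (1 - B₂ * θ₂ * c * c)⁻¹ := inv_nonneg.mpr (by linarith)
  have hK₄0 : 0 ≤ B₂ + B₂ * (θ₂ * (B₂ * (1 - B₂ * θ₂ * c * c)⁻¹) * c) * c :=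
    add_nonneg hB₂ (mul_nonneg (mul_nonneg hB₂ (mul_nonneg (mul_nonneg hθ₂ (mul_nonneg hB₂ hq₂1)) hc)) hc)
  have hNP1 : 0 ≤ NP * Λ₁ := mul_nonneg hNP0 hΛ₁0
  have hNPm : 0 ≤ NP * Λm := mul_nonneg hNP0 hΛm
  have hKL0 : 0 ≤ constL2N B₀ θ θD B₂ θ₂ c Λ₁ Λh Λm NP := by
    unfold constL2N
    have h1 : 0 ≤ B₀ * (1 - θ * c)⁻¹ * Λ₁ := mul_nonneg hB₀'0 hΛ₁0
    have h2 : 0 ≤ (B₀ + θD * (B₀ * (1 - θ * c)⁻¹) * c + B₀ * (1 - θ * c)⁻¹) * Λh := mul_nonneg (add_nonneg hC₁0 hB₀'0) hΛh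
    have h3 : 0 ≤ (B₂ + B₂ * (θ₂ * (B₂ * (1 - B₂ * θ₂ * c * c)⁻¹) * c) * c) * (1 + NP * Λ₁ + NP * Λm) :=
      mul_nonneg hK₄0 (by linarith)
    linarith
  -- the mixed pair family: K₄·N_P ≦ K₄·N_P·Λ₁ ≦ constL2N (Λ₁ ≧ 1)
  have hNPle : NP ≤ NP * Λ₁ := le_mul_of_one_le_right hNP0 hΛ₁
  have hKL3 : NP * (B₂ + B₂ * (θ₂ * (B₂ * (1 - B₂ * θ₂ * c * c)⁻¹) * c) * c) ≤ constL2N B₀ θ θD B₂ θ₂ c Λ₁ Λh Λm NP := by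
    unfold constL2N
    have h1 : 0 ≤ B₀ * (1 - θ * c)⁻¹ * Λ₁ := mul_nonneg hB₀'0 hΛ₁0
    have h2 : 0 ≤ (B₀ + θD * (B₀ * (1 - θ * c)⁻¹) * c + B₀ * (1 - θ * c)⁻¹) * Λh := mul_nonneg (add_nonneg hC₁0 hB₀'0) hΛh
    have h3 : NP * (B₂ + B₂ * (θ₂ * (B₂ * (1 - B₂ * θ₂ * c * c)⁻¹) * c) * c) ≤
        (B₂ + B₂ * (θ₂ * (B₂ * (1 - B₂ * θ₂ * c * c)⁻¹) * c) * c) * (1 + NP * Λ₁ + NP * Λm) := by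
      rw [mul_comm NP]
      exact mul_le_mul_of_nonneg_left (by linarith) hK₄0
    linarith
  -- rates for the second-order Neumann bookkeeping: ρ_f + αρ with the schemas brought to the common rate ρ (as upstream)
  have hαρ : 0 ≤ α * ρ := mul_nonneg hα hρ
  have hρL0 : 0 ≤ ρf + α * ρ := add_nonneg hρf hαρ
  have hρL2 : ρf + α * ρ + 2 * σ ≤ ρ := by linarith
  have hexp : ∀ {r₁ r' : ℝ}, r' ≤ r₁ → ∀ y y' : g.Site, Real.exp (-(r₁ * g.dist y y')) ≤ Real.exp (-(r' * g.dist y y')) :=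
    fun h y y' => Real.exp_le_exp.mpr (neg_le_neg (mul_le_mul_of_nonneg_right h (hG.dnn y y')))
  have hfix : A = 𝔬.G0 U + 𝔬.G0 U ∘ₗ T ∘ₗ A := fix_of_inverses hI0 hIA
  have hL2ρ : Thm33G0L2M 𝔬 Dd Dds R₀ H₀ B₂ ρ U := by
    have hl : ∀ y : g.Site, 0 ≤ g.len y := hG.lenle
    have hli : ∀ y : g.Site, 0 ≤ (g.len y)⁻¹ := fun y => inv_nonneg.mpr (hl y)
    exact
      { l0 := hL2.l0.mono fun y y' => mul_le_mul_of_nonneg_left (hexp hρS y y') (mul_nonneg (mul_nonneg hB₂ (hl y)) (hl y'))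
        l1 := hL2.l1.mono fun y y' => mul_le_mul_of_nonneg_left (hexp hρS y y') (mul_nonneg hB₂ (hl y'))
        l2 := hL2.l2.mono fun y y' => mul_le_mul_of_nonneg_left (hexp hρS y y') (mul_nonneg hB₂ (hl y))
        l3 := fun q => (hL2.l3 q).mono fun y y' =>
          mul_le_mul_of_nonneg_left (hexp hρS y y') (mul_nonneg hB₂ (mul_nonneg (hli y) (hl y')))
        l4 := hL2.l4.mono fun y y' => mul_le_mul_of_nonneg_left (hexp hρS y y') hB₂
        l5 := fun q => (hL2.l5 q).mono fun y y' =>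
          mul_le_mul_of_nonneg_left (hexp hρS y y') (mul_nonneg hB₂ (mul_nonneg (hl y) (hli y')))
        l1d := fun ν => (hL2.l1d ν).mono fun y y' => mul_le_mul_of_nonneg_left (hexp hρS y y') (mul_nonneg hB₂ (hl y'))
        l2d := fun μ => (hL2.l2d μ).mono fun y y' => mul_le_mul_of_nonneg_left (hexp hρS y y') (mul_nonneg hB₂ (hl y))
        l4m := fun q => (hL2.l4m q).mono fun y y' => mul_le_mul_of_nonneg_left (hexp hρS y y') hB₂ }
  have hT2ρ : BlockBd (g := toB6 g R₀ H₀) 𝔬.blk 𝔬.blk T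
      (fun (y y' : g.Site) => θ₂ * (g.len y)⁻¹ * (g.len y')⁻¹ * Real.exp (-(ρ * g.dist y y'))) :=
    hT2.mono fun y y' => mul_le_mul_of_nonneg_left (hexp (by linarith) y y')
      (mul_nonneg (mul_nonneg hθ₂ (inv_nonneg.mpr (hG.lenle y))) (inv_nonneg.mpr (hG.lenle y')))
  have hb3 := l2bd_mixedFamily_of_step hG hrow hB₂ hθ₂ hρL0 hσ hρL2 hL2ρ hT2ρ hfix hq₂
  have hP3 : ∀ t : ℝ, B9.pref6 t 3 = 1 := fun t => by simp [B9.pref6]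
  have hB3f : BlockBd (g := toB6 g R₀ H₀) 𝔬.blk (𝔬.blk ∘ Prod.fst) (familyOp (fun q : P × P => Dd U q.1 ∘ₗ (A ∘ₗ Dds U q.2)))
      (fun (y y' : g.Site) => constL2N B₀ θ θD B₂ θ₂ c Λ₁ Λh Λm NP * B9.pref6 (g.len y) 3 * Real.exp (-(ρf * g.dist y y'))) := by
    refine hb3.mono fun y y' => ?_
    rw [hP3, mul_one]
    calc NP * ((B₂ + B₂ * (θ₂ * (B₂ * (1 - B₂ * θ₂ * c * c)⁻¹) * c) * c) * Real.exp (-((ρf + α * ρ) * g.dist y y')))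
        = NP * (B₂ + B₂ * (θ₂ * (B₂ * (1 - B₂ * θ₂ * c * c)⁻¹) * c) * c) * Real.exp (-((ρf + α * ρ) * g.dist y y')) := by ring
      _ ≤ constL2N B₀ θ θD B₂ θ₂ c Λ₁ Λh Λm NP * Real.exp (-(ρf * g.dist y y')) :=
          mul_le_mul hKL3 (hexp (by linarith) y y') (Real.exp_nonneg _) hKL0
  -- the record order: 3 = the mixed pair family, 4 = ∇∇A, 5 = A∇\*∇\* (pref6 = 1 on all three)
  have hP34 : ∀ t : ℝ, B9.pref6 t 3 = B9.pref6 t 4 := fun t => by simp [B9.pref6]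
  have hB4f' : BlockBd (g := toB6 g R₀ H₀) 𝔬.blk (𝔬.blk ∘ Prod.fst) (familyOp (fun q : P × P => (Dd U q.1 ∘ₗ Dd U q.2) ∘ₗ A))
      (fun (y y' : g.Site) => constL2N B₀ θ θD B₂ θ₂ c Λ₁ Λh Λm NP * B9.pref6 (g.len y) 4 * Real.exp (-(ρf * g.dist y y'))) :=
    hB4f.mono fun y y' => by rw [hP34]
  intro n
  fin_cases n
  · exact l2line_of_blockBd_nbr hl0 hRd₂ hmult hnbr hCL1 hCL hG.tri hG.symm hKL0 hρf hCev hG.lenle hB0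
  · exact l2line_of_blockBd_nbr hl1 hRd₂ hmult hnbr hCL1 hCL hG.tri hG.symm hKL0 hρf hCev hG.lenle hB1
  · exact l2line_of_blockBd_nbr hl2 hRd₂ hmult hnbr hCL1 hCL hG.tri hG.symm hKL0 hρf hCev hG.lenle hB2
  · exact l2line_of_blockBd_nbr hl3 hRd₂ hmult hnbr hCL1 hCL hG.tri hG.symm hKL0 hρf hCev hG.lenle hB3f
  · exact l2line_of_blockBd_nbr hl4 hRd₂ hmult hnbr hCL1 hCL hG.tri hG.symm hKL0 hρf hCev hG.lenle hB4f'
  · exact l2line_of_blockBd_nbr hl5 hRd₂ hmult hnbr hCL1 hCL hG.tri hG.symm hKL0 hρf hCev hG.lenle hB5f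

/-- ★ **THEOREM 3.12 — THE HÖLDER BLOCK (3.43)–(3.45) OF A KERNEL FAMILY CO-READ BY ONE SECT.-D PROPAGATOR, THE INPUT MEMBERS ON THE PAIR FAMILY**
(the twin of `…BlocksNbr.holder_of_step_nbr` with the (3.44)∕(3.45) co-reading moved from the one-slot composite to `InputReadsFam … (blk ∘ Prod.fst)
(blkPX ∘ Prod.fst) (fun β => sliceProbe (Φ^X_β U)) ev (familyOp (q ↦ ∇_{U,q.1} ∘ A ∘ ∇\*_{U,q.2}))`).  Data at U: A with (Δ_a − T)A = I and G₀Δ_a =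
I; Theorem 3.3 for G₀ — (3.42)₁,₃ one-slot (`he0 he2`) and the direction-indexed schema `hH0 : Thm33G0Dir …`; the perturbation step on 𝔠⁽²⁾
(`hK2`), on 𝔠⁽¹⁾ (`hK1`), and the direction-indexed step members (`hsDd hpY hpX hpXd htDd`, the fields of `StepDir` at T; the one-slot
derivative of the step is no longer needed: the left entry enters (3.44)∕(3.45) per direction); [4] Lemma 2.1 as the row sum at σ and the scale
transfer at γ = 1; the co-readings `H1ReadsNbr` (one-slot ∇_UA, A∇\*_U) and
`InputReadsFam` (the family); the class data and the neighbourhood data (r ≧ 0, CL ≧ 1).  Provisos: ρ ≦ δ₀, ρ + σ ≦ δ_K, θc < 1, 0 ≦ ρ_f,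
ρ_f + σ ≦ (1 − α)ρ.  Conclusion: `B9.Ineq343_345 K (m·CL·e^{rρ_f}·(B_h + θ_HB₀(1 − θc)⁻¹c)) (e^{rρ_f}·(B_i + C₁′Λ₁θ_Hc))
(CL·e^{rρ_f}·(B_i2 + (B_h + θ_HB₀(1 − θc)⁻¹c)Λ₁θ_Hc)) ρ_f U`, C₁′ = B₀ + θ_DB₀(1 − θc)⁻¹c the per-direction (3.42)₂ constant.  Nothing of print
asserted. [cite: Balaban1985BackgroundPropagators, Thm 3.12 p.423 + Thm 3.3 p.399 + (3.43)–(3.45) p.398 + (3.39)–(3.40) p.397 + (3.130)–(3.131) pp.421–422 + (3.138) p.423; Balaban1984PropagatorsII, (2.51)–(2.52) p.232 + Lemma 2.1 (2.60)–(2.61) p.234] -/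
theorem holder_of_step_pairM (hG : GeoOK g) {K : B9.KernelFamily g B} {U : B.Cfg} (𝔬 : Ops g B X Y Z W)
    (𝔭 : HolderProbes g B X Y PX PY) (Dd Dds : B.Cfg → P → Module.End ℝ (X → ℝ)) (bHX : ℝ → BlockNorm (toB6 g R₀ H₀) (X → ℝ))
    (Rel : g.Site → g.Site → Prop) [DecidableRel Rel] (ev : g.Loc → X → ℝ) (evY : g.Loc → Y → ℝ)
    {A T : Module.End ℝ (X → ℝ)} {m : ℕ}
    {r CL θ θD θH B₀ δ₀ δK ρ ρf σ α c Λ₁ : ℝ} {Bh Bi : ℝ → ℝ} {Bi2 : ℝ → ℝ → ℝ}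
    (hrow : RowSum (toB6 g R₀ H₀) σ c)
    (hθ : 0 ≤ θ) (hθD : 0 ≤ θD) (hθH : 0 ≤ θH) (hB₀ : 0 ≤ B₀) (hσ : 0 ≤ σ) (hα : 0 ≤ α)
    (hρ : 0 ≤ ρ) (hρS : ρ ≤ δ₀) (hρδ : ρ + σ ≤ δK) (hq : θ * c < 1)
    (hρf : 0 ≤ ρf) (hρf1 : ρf + σ ≤ (1 - α) * ρ) (hΛ₁ : 0 ≤ Λ₁)
    (hBh : ∀ β, 0 ≤ β → β < 1 → 0 ≤ Bh β) (hBi : ∀ ε, 0 < ε → ε ≤ 1 → 0 ≤ Bi ε)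
    (hBi2 : ∀ ε β, 0 < ε → ε ≤ 1 → 0 ≤ β → β < 1 → 0 ≤ Bi2 ε β)
    (hST1 : ScaleTransfer g ρ α Λ₁ (fun y => g.len y ^ (1 : ℝ)))
    (hI0 : 𝔬.G0 U * 𝔬.S0 U = 1) (hIA : (𝔬.S0 U - T) * A = 1)
    (he0 : HasMajorant (g := toB6 g R₀ H₀) 𝔬.blk (𝔬.G0 U) (fun a b => B₀ * g.len a ^ 2 * Real.exp (-(δ₀ * g.dist a b))))
    (he2 : HasMajorantHom (g := toB6 g R₀ H₀) 𝔬.blkY 𝔬.blk (𝔬.G0 U ∘ₗ 𝔬.Dstar U)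
      (fun (a b : g.Site) => B₀ * g.len a * Real.exp (-(δ₀ * g.dist a b))))
    (hH0 : Thm33G0Dir 𝔬 𝔭 Dd Dds R₀ H₀ bHX B₀ Bh Bi Bi2 δ₀ U)
    (hK1 : HasMaj (cNorm R₀ H₀ 𝔬.blk hG.lenle 1) (cNorm R₀ H₀ 𝔬.blk hG.lenle 1) (𝔬.G0 U ∘ₗ T)
      (fun a b => θ * Real.exp (-(δK * g.dist a b))))
    (hK2 : HasMaj (cNorm R₀ H₀ 𝔬.blk hG.lenle 2) (cNorm R₀ H₀ 𝔬.blk hG.lenle 2) (𝔬.G0 U ∘ₗ T)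
      (fun a b => θ * Real.exp (-(δK * g.dist a b))))
    (hsDd : ∀ ν : P, HasMaj (cNorm R₀ H₀ 𝔬.blk hG.lenle 2) (cNorm R₀ H₀ 𝔬.blk hG.lenle 1) (Dd U ν ∘ₗ 𝔬.G0 U ∘ₗ T)
      (fun a b => θD * Real.exp (-(δK * g.dist a b))))
    (hpY : ∀ β : ℝ, 0 ≤ β → β < 1 → HasMaj (cNormR R₀ H₀ 𝔬.blk hG.lenle (-2)) (cNormR R₀ H₀ 𝔭.blkPY hG.lenle (β - 1))
      ((𝔭.ΦY U β ∘ₗ 𝔬.D U ∘ₗ 𝔬.G0 U) ∘ₗ T) (fun a b => θH * Real.exp (-(δK * g.dist a b))))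
    (hpX : ∀ β : ℝ, 0 ≤ β → β < 1 → HasMaj (cNormR R₀ H₀ 𝔬.blk hG.lenle (-1)) (cNormR R₀ H₀ 𝔭.blkPX hG.lenle (β - 1))
      ((𝔭.ΦX U β ∘ₗ 𝔬.G0 U) ∘ₗ T) (fun a b => θH * Real.exp (-(δK * g.dist a b))))
    (hpXd : ∀ (ν : P) (β : ℝ), 0 ≤ β → β < 1 → HasMaj (cNormR R₀ H₀ 𝔬.blk hG.lenle (-2)) (cNormR R₀ H₀ 𝔭.blkPX hG.lenle (β - 1))
      ((𝔭.ΦX U β ∘ₗ Dd U ν ∘ₗ 𝔬.G0 U) ∘ₗ T) (fun a b => θH * Real.exp (-(δK * g.dist a b))))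
    (htDd : ∀ (μ : P) (ε : ℝ), 0 < ε → HasMaj (bHX ε) (cNormR R₀ H₀ 𝔬.blk hG.lenle 1) (T ∘ₗ (𝔬.G0 U ∘ₗ Dds U μ))
      (fun a b => θH * Real.exp (-(δK * g.dist a b))))
    (hRd₂ : ∀ a b b', Rel b b' → g.dist a b = g.dist a b')
    (hmult : ∀ y' : g.Site, (Finset.univ.filter (fun y'' => Rel y'' y')).card ≤ m)
    (hCL1 : 1 ≤ CL) (hCL : ∀ a a' : g.Site, g.dist a a' ≤ r → g.len a ≤ CL * g.len a')
    (hH1 : H1ReadsNbr K U 𝔭 Rel r 𝔬.blk 𝔬.blkY ev evY (𝔬.D U ∘ₗ A) (A ∘ₗ 𝔬.Dstar U))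
    (hIR : InputReadsFam K U bHX r (𝔬.blk ∘ Prod.fst) (𝔭.blkPX ∘ Prod.fst) (fun β => sliceProbe (𝔭.ΦX U β)) ev
      (familyOp (fun q : P × P => Dd U q.1 ∘ₗ (A ∘ₗ Dds U q.2)))) :
    B9.Ineq343_345 K (fun β => m * CL * Real.exp (r * ρf) * (Bh β + θH * (B₀ * (1 - θ * c)⁻¹) * c))
      (fun ε => Real.exp (r * ρf) * (Bi ε + (B₀ + θD * (B₀ * (1 - θ * c)⁻¹) * c) * Λ₁ * θH * c))
      (fun ε β => CL * Real.exp (r * ρf) * (Bi2 ε β + (Bh β + θH * (B₀ * (1 - θ * c)⁻¹) * c) * Λ₁ * θH * c)) ρf U := by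
  -- adapted from `B9Thm312WholeBlocksNbr.holder_of_step_nbr` ((3.44)∕(3.45) on the pair family)
  have hc : 0 ≤ c ∨ IsEmpty g.Site := by
    by_cases hne : Nonempty g.Site
    · exact Or.inl (hrow.nonneg hne.some)
    · exact Or.inr (not_nonempty_iff.mp hne)
  rcases hc with hc | hemp
  swap
  · exact ⟨fun β lam ζ y => (hemp.false y).elim, fun ε lam y => (hemp.false y).elim, fun ε β lam ζ y => (hemp.false y).elim⟩
  have hq1 : 0 ≤ (1 - θ * c)⁻¹ := inv_nonneg.mpr (by linarith)
  have hB₀'0 : 0 ≤ B₀ * (1 - θ * c)⁻¹ := mul_nonneg hB₀ hq1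
  have hC₁0 : 0 ≤ B₀ + θD * (B₀ * (1 - θ * c)⁻¹) * c := add_nonneg hB₀ (mul_nonneg (mul_nonneg hθD hB₀'0) hc)
  have hαρ : 0 ≤ α * ρ := mul_nonneg hα hρ
  have hρfρ : ρf ≤ ρ := by linarith
  have hρfK : ρf ≤ δK := by linarith
  have hρf0 : ρf ≤ δ₀ := hρfρ.trans hρS
  have hexp : ∀ {r₁ r' : ℝ}, r' ≤ r₁ → ∀ y y' : g.Site, Real.exp (-(r₁ * g.dist y y')) ≤ Real.exp (-(r' * g.dist y y')) :=
    fun h y y' => Real.exp_le_exp.mpr (neg_le_neg (mul_le_mul_of_nonneg_right h (hG.dnn y y')))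
  have hfix : A = 𝔬.G0 U + 𝔬.G0 U ∘ₗ T ∘ₗ A := fix_of_inverses hI0 hIA
  have hfixR : A = 𝔬.G0 U + A ∘ₗ T ∘ₗ 𝔬.G0 U := fix_right_of_inverses hI0 hIA
  have hBhA : ∀ β, 0 ≤ β → β < 1 → 0 ≤ Bh β + θH * (B₀ * (1 - θ * c)⁻¹) * c := fun β h0 h1 =>
    add_nonneg (hBh β h0 h1) (mul_nonneg (mul_nonneg hθH hB₀'0) hc)
  -- (3.43) at the rate ρ, weakened to ρf (one-slot, unchanged)
  have h43L : ∀ β, 0 ≤ β → β < 1 → HasMajorantHom (g := toB6 g R₀ H₀) 𝔬.blk 𝔭.blkPY (𝔭.ΦY U β ∘ₗ (𝔬.D U ∘ₗ A))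
      (fun (a b : g.Site) => (Bh β + θH * (B₀ * (1 - θ * c)⁻¹) * c) * g.len a ^ (1 - β) * Real.exp (-(ρf * g.dist a b))) := by
    intro β h0 h1
    have h := probe43L_of_step hG 𝔭 hrow hθ hθH hB₀ (hBh β h0 h1) hρ hρS hρδ hK2 he0 (hH0.h43L β h0 h1) (hpY β h0 h1) hfix hq
    exact hasMajorantHom_mono (g := toB6 g R₀ H₀) 𝔬.blk 𝔭.blkPY h fun a b =>
      mul_le_mul_of_nonneg_left (hexp hρfρ a b) (mul_nonneg (hBhA β h0 h1) (Real.rpow_nonneg (hG.lenle a) _))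
  have h43R : ∀ β, 0 ≤ β → β < 1 → HasMajorantHom (g := toB6 g R₀ H₀) 𝔬.blkY 𝔭.blkPX (𝔭.ΦX U β ∘ₗ (A ∘ₗ 𝔬.Dstar U))
      (fun (a b : g.Site) => (Bh β + θH * (B₀ * (1 - θ * c)⁻¹) * c) * g.len a ^ (1 - β) * Real.exp (-(ρf * g.dist a b))) := by
    intro β h0 h1
    have h := probe43R_of_step hG 𝔭 hrow hθ hθH hB₀ (hBh β h0 h1) hρ hρS hρδ hK1 he2 (hH0.h43R β h0 h1) (hpX β h0 h1) hfix hq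
    exact hasMajorantHom_mono (g := toB6 g R₀ H₀) 𝔬.blkY 𝔭.blkPX h fun a b =>
      mul_le_mul_of_nonneg_left (hexp hρfρ a b) (mul_nonneg (hBhA β h0 h1) (Real.rpow_nonneg (hG.lenle a) _))
  -- the per-direction left entries ∇_{U,ν}A at the rate ρ
  have hm1d : ∀ ν : P, HasMajorantHom (g := toB6 g R₀ H₀) 𝔬.blk 𝔬.blk (Dd U ν ∘ₗ A)
      (fun a b => (B₀ + θD * (B₀ * (1 - θ * c)⁻¹) * c) * g.len a * Real.exp (-(ρ * g.dist a b))) := fun ν =>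
    entry1_of_stepD hG hrow hθ hθD hB₀ hρ hρS hρδ hK2 (hsDd ν) he0 (hH0.e1d ν) hfix hq
  -- (3.44), (3.45) on the pair family at the rate ρf through the right form
  have h44 : ∀ ε, 0 < ε → ε ≤ 1 → HasMaj (bHX ε) (BlockNorm.ofBlocks (toB6 g R₀ H₀) (𝔬.blk ∘ Prod.fst))
      (familyOp (fun q : P × P => Dd U q.1 ∘ₗ (A ∘ₗ Dds U q.2)))
      (fun (a b : g.Site) => (Bi ε + (B₀ + θD * (B₀ * (1 - θ * c)⁻¹) * c) * Λ₁ * θH * c) *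
        Real.exp (-(ρf * g.dist a b))) := fun ε h0 h1 =>
    input44_family_of_step hG hrow hθH (hBi ε h0 h1) hC₁0 hΛ₁ hρf hρf1 hρfK hρf0 hST1 hm1d (fun q => hH0.h44m q ε h0 h1)
      (fun μ => htDd μ ε h0) hfixR
  have h45 : ∀ ε β, 0 < ε → ε ≤ 1 → 0 ≤ β → β < 1 →
      HasMaj (bHX (β + ε)) (BlockNorm.ofBlocks (toB6 g R₀ H₀) (𝔭.blkPX ∘ Prod.fst))
        (sliceProbe (𝔭.ΦX U β) ∘ₗ familyOp (fun q : P × P => Dd U q.1 ∘ₗ (A ∘ₗ Dds U q.2)))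
        (fun (a b : g.Site) => (Bi2 ε β + (Bh β + θH * (B₀ * (1 - θ * c)⁻¹) * c) * Λ₁ * θH * c) * g.len a ^ (-β) *
          Real.exp (-(ρf * g.dist a b))) := fun ε β hε0 hε1 h0 h1 =>
    input45_family_of_step hG hrow hθ hθH hB₀ (hBh β h0 h1) (hBi2 ε β hε0 hε1 h0 h1) hΛ₁ hρ hρS hρδ hρf hρf1 hρfK hρf0 hST1 hK2
      he0 (fun ν => hH0.h43d ν β h0 h1) (fun ν => hpXd ν β h0 h1) (fun q => hH0.h45m q ε β hε0 hε1 h0 h1)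
      (fun μ => htDd μ (β + ε) (by linarith)) hfix hfixR hq
  exact ineq343_345_of_majorants_pairM (R := R₀) (H := H₀) hG 𝔭 bHX hRd₂ hmult hCL1 hCL hBhA
    (fun ε h0 h1 => add_nonneg (hBi ε h0 h1) (mul_nonneg (mul_nonneg (mul_nonneg hC₁0 hΛ₁) hθH) hc))
    (fun ε β hε0 hε1 h0 h1 => add_nonneg (hBi2 ε β hε0 hε1 h0 h1)
      (mul_nonneg (mul_nonneg (mul_nonneg (hBhA β h0 h1) hΛ₁) hθH) hc))
    hρf h43L h43R h44 h45 hH1 hIR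

end OneMember

end

end Literature.MathematicalPhysics.QuantumFieldTheory.Balaban1983to89.B9Thm312WholeBlocksPairM
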